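import Summits.BirchSwinnertonDyer.BirchSwinnertonDyer.Theorems.ThetaPartnerAtTwoSignedKatoUpToAtTwoHondaLogCharSums
import Literature.NumberTheory.EllipticCurves.PAdicLFunctionIntegralityAtTwoProofs
import HarnessLib

/-!
# Route `ThetaPartnerAtTwo` (TP2), crux K3 `SignedKatoDivisibilityUpToAtTwo` (item stmt-BirchSwinnertonDyer-20308), line `colemanrat` —
# (R3) part 3: the bridge between the layer enumeration `g^j, j < 2^n` (`pairingSum`, `χ(5)^j`) and Dirichlet-character sums mod `2^{n+2}`

Width seat `bsd-wall-tp2-p2x-w2` g5 (cell `bsd-wall`). HONEST FRAMING: theorems only (no definition, no named fact, no instance,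
no `sorry`); generic algebra — nothing about any curve is asserted; closes no item; K3 is NOT settled and BSD is NOT proved by any of this.

## What is here (same namespace as `…HondaLogCharSums(Ell)`)

In the character-value form of the finite-level explicit reciprocity law (w3 g6's CORE_pairχ socket) the pairing sum
`P_{n,d_n}(z)` of line `colemanrat` is evaluated at `χ(5) − 1`: `P_n(z)(χ(5) − 1) = ∑_{j<2ⁿ} χ(5)^j ⟨z, gʲ d_n⟩`, an enumeration of
`G_n = Gal(ℚ_{2,n}/ℚ₂) ≅ (ℤ/2^{n+2})ˣ/{±1} = ⟨5⟩` by the powers of the local generator `g` (`χ_cyc(g) ≡ ±5`), while Kobayashi's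
Prop. 8.26 / Kato's Thm. 12.5 / Birch's formula are sums over Dirichlet characters `χ` mod `2^{n+2}`, i.e. over ALL units `±5^j`. For an
EVEN character (`χ(−1) = 1`, the characters of `ℚ_{2,n} = ℚ₂(ζ_{2^{n+2}})⁺`) the two agree:

* `sum_mulChar_eq_sum_units_two` — `∑_{a : ℤ/2^{n+2}} χ(a) G(a) = ∑_{s : ℤ/2ⁿ} (χ(5^s) G(5^s) + χ(−5^s) G(−5^s))` for ANY `G` and any
  Dirichlet character `χ` mod `2^{n+2}` (MulChar convention `χ = 0` off units; units `= {±5^s}`: the tree's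
  `finsum_sum_classes_eq_sum_units` at `p = 2`, `cyclotomicGenerator 2 = 5`, `μ_{torsionOrder 2}(ℤ₂) = {±1}`);
* `sum_mulChar_eq_sum_pow_five_of_even` — for EVEN `χ`: `∑_a χ(a) G(a) = ∑_{s : ℤ/2ⁿ} χ(5^s)·(G(5^s) + G(−5^s))` — with
  `G(a) = σ_a(ℓ_{n+2})` the right-hand side is `∑_j χ(5)^j · gʲ(ℓ_{n+2} + σℓ_{n+2})`, the character sum of the logarithms
  `log d_n = 3(ℓ_{n+2} + σℓ_{n+2}) + 4` of the tree's plus Honda points (`…LocalTwoPlusPoints`), so that `…HondaLogCharSumsEll.sum_changeLevel_mul_ellConj`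
  evaluates it.

References: [Kobayashi2003] Prop. 8.26 (p. 24); [MazurTateTeitelbaum1986Invent] §I.13 (`ℤ₂ˣ = {±1} × 5^{ℤ₂}`); [Washington1997] §7.2.
-/

set_option autoImplicit false
-- the Theorems namespace of this sub repeats the summit name by design (D-0017 nested layout)
set_option linter.dupNamespace false

noncomputable section

open scoped Classical

open DirichletCharacter Finset Literature.NumberTheory.EllipticCurves

namespace Summit.BirchSwinnertonDyer.BirchSwinnertonDyer.Theorems.SignedKatoOffTwo.HondaLogChi

variable {R : Type*} [CommRing R]

/-- `Σᶠ_{ξ ∈ μ₂(ℤ₂)} g(ξ) = g(1) + g(−1)` (copy of the private helper of `PAdicLFunctionIntegralityAtTwoSplitMultProofs`). [folklore] -/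
theorem finsum_rootsOfUnity_two {M : Type*} [AddCommMonoid M] (g : ℤ_[2] → M) :
    ∑ᶠ ξ : rootsOfUnity 2 ℤ_[2], g ((ξ : ℤ_[2]ˣ) : ℤ_[2]) = g 1 + g (-1) := by
  classical
  have hζmem : (-1 : ℤ_[2]ˣ) ∈ rootsOfUnity 2 ℤ_[2] := by
    rw [mem_rootsOfUnity]; norm_num
  set ζ : rootsOfUnity 2 ℤ_[2] := ⟨-1, hζmem⟩ with hζ
  have hne : (1 : rootsOfUnity 2 ℤ_[2]) ≠ ζ := by
    intro h
    have h' : (((1 : rootsOfUnity 2 ℤ_[2]) : ℤ_[2]ˣ) : ℤ_[2]) = ((ζ : ℤ_[2]ˣ) : ℤ_[2]) := by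
      rw [h]
    rw [hζ] at h'
    simp only [OneMemClass.coe_one, Units.val_one, Units.val_neg] at h'
    have h2 : (2 : ℤ_[2]) = 0 := by linear_combination h'
    exact two_ne_zero h2
  haveI : Fintype (rootsOfUnity 2 ℤ_[2]) := Fintype.ofFinite _
  have huniv : (Finset.univ : Finset (rootsOfUnity 2 ℤ_[2])) = {1, ζ} := by
    ext ξ
    simp only [Finset.mem_univ, Finset.mem_insert, Finset.mem_singleton, true_iff]
    -- `ξ = ±1`: `ξ² = 1` in the domain `ℤ₂`
    have hsq : (((ξ : ℤ_[2]ˣ) : ℤ_[2])) ^ 2 = 1 := by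
      rw [← Units.val_pow_eq_pow_val, (mem_rootsOfUnity _ _).mp ξ.2, Units.val_one]
    rcases sq_eq_one_iff.mp hsq with h | h
    · left
      exact Subtype.ext (Units.ext (by simpa using h))
    · right
      exact Subtype.ext (Units.ext (by rw [hζ]; simpa using h))
  rw [finsum_eq_sum_of_fintype, huniv, Finset.sum_pair hne]
  simp only [OneMemClass.coe_one, Units.val_one, hζ, Units.val_neg]

/-- **Units of `ℤ/2^{n+2}` are `±5^s`, `s mod 2ⁿ`**: for a Dirichlet character `χ` mod `2^{n+2}` (vanishing off the units) and any `G`,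
`∑_{a : ℤ/2^{n+2}} χ(a) G(a) = ∑_{s : ℤ/2ⁿ} (χ(5^s) G(5^s) + χ(−5^s) G(−5^s))` — the tree's `finsum_sum_classes_eq_sum_units` at
`p = 2` (`cyclotomicExponent 2 = 2`, `cyclotomicGenerator 2 = 5`, torsion `{±1}`). [cite: MazurTateTeitelbaum1986Invent, §I.13] -/
theorem sum_mulChar_eq_sum_units_two (n : ℕ) (χ : DirichletCharacter R (2 ^ (n + 2))) (G : ZMod (2 ^ (n + 2)) → R) :
    ∑ a : ZMod (2 ^ (n + 2)), χ a * G a =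
      ∑ s : ZMod (2 ^ n), (χ ((5 : ZMod (2 ^ (n + 2))) ^ s.val) * G ((5 : ZMod (2 ^ (n + 2))) ^ s.val) +
        χ (-(5 : ZMod (2 ^ (n + 2))) ^ s.val) * G (-(5 : ZMod (2 ^ (n + 2))) ^ s.val)) := by
  classical
  -- only units contribute
  have hunits : ∑ a : ZMod (2 ^ (n + 2)), χ a * G a = ∑ u : (ZMod (2 ^ (n + 2)))ˣ, χ u * G u := by
    rw [sum_units_eq_sum_filter_isUnit (F := fun a ↦ χ a * G a), Finset.sum_filter]
    refine Finset.sum_congr rfl fun a _ ↦ ?_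
    split_ifs with ha
    · rfl
    · rw [MulChar.map_nonunit χ ha, zero_mul]
  rw [hunits]
  -- units `= η · γ^s`, `η ∈ {±1}`, `γ = 5` (the tree's enumeration at `p = 2`; `cyclotomicExponent 2 = 2` definitionally)
  have h := finsum_sum_classes_eq_sum_units 2 n (fun u ↦ χ u * G u)
  rw [torsionOrder_two] at h
  have h' : ∑ᶠ η : rootsOfUnity 2 ℤ_[2], ∑ s : ZMod (2 ^ n),
      χ (PadicInt.toZModPow (n + 2) ((η : ℤ_[2]ˣ) : ℤ_[2]) * ((cyclotomicGenerator 2 : ℕ) : ZMod (2 ^ (n + 2))) ^ s.val) *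
        G (PadicInt.toZModPow (n + 2) ((η : ℤ_[2]ˣ) : ℤ_[2]) * ((cyclotomicGenerator 2 : ℕ) : ZMod (2 ^ (n + 2))) ^ s.val) =
      ∑ u : (ZMod (2 ^ (n + 2)))ˣ, χ u * G u := h
  rw [finsum_rootsOfUnity_two (fun x ↦ ∑ s : ZMod (2 ^ n),
      χ (PadicInt.toZModPow (n + 2) x * ((cyclotomicGenerator 2 : ℕ) : ZMod (2 ^ (n + 2))) ^ s.val) *
        G (PadicInt.toZModPow (n + 2) x * ((cyclotomicGenerator 2 : ℕ) : ZMod (2 ^ (n + 2))) ^ s.val))] at h'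
  rw [cyclotomicGenerator_two, map_one, map_neg, map_one] at h'
  simp only [Nat.cast_ofNat, one_mul, neg_one_mul] at h'
  rw [← h', ← Finset.sum_add_distrib]

/-- **Even characters: the `⟨5⟩`-enumeration.** For an EVEN Dirichlet character `χ` mod `2^{n+2}` (`χ(−1) = 1`) and any `G`:
`∑_{a : ℤ/2^{n+2}} χ(a) G(a) = ∑_{s : ℤ/2ⁿ} χ(5^s)·(G(5^s) + G(−5^s))`. With `G = σ_•(ℓ_{n+2})` the summand is
`χ(5)^s · gˢ(ℓ_{n+2} + σℓ_{n+2})` (`χ_cyc(g) ≡ ±5`, `ℓ + σℓ` is `±`-symmetric), i.e. the character sum of the logarithms of the plus Honda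
points along the powers of the local generator — the quantity Kobayashi's Prop. 8.26 evaluates (`sum_changeLevel_mul_ellConj`).
[cite: Kobayashi2003, Prop. 8.26 (p. 24)] [cite: MazurTateTeitelbaum1986Invent, §I.13] -/
theorem sum_mulChar_eq_sum_pow_five_of_even (n : ℕ) (χ : DirichletCharacter R (2 ^ (n + 2))) (hχ : χ (-1) = 1)
    (G : ZMod (2 ^ (n + 2)) → R) :
    ∑ a : ZMod (2 ^ (n + 2)), χ a * G a =
      ∑ s : ZMod (2 ^ n), χ ((5 : ZMod (2 ^ (n + 2))) ^ s.val) *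
        (G ((5 : ZMod (2 ^ (n + 2))) ^ s.val) + G (-(5 : ZMod (2 ^ (n + 2))) ^ s.val)) := by
  rw [sum_mulChar_eq_sum_units_two]
  refine Finset.sum_congr rfl fun s _ ↦ ?_
  rw [← neg_one_mul ((5 : ZMod (2 ^ (n + 2))) ^ s.val), map_mul, hχ, one_mul, neg_one_mul, mul_add]

end Summit.BirchSwinnertonDyer.BirchSwinnertonDyer.Theorems.SignedKatoOffTwo.HondaLogChi

end
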